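import Literature.Computability.Complexity.GateEliminationTransfer
import Literature.Computability.Complexity.GateEliminationOutput
import Literature.Computability.Complexity.GateEliminationXorMap

/-!
# Gate elimination, XII: the normalization lemma for Rules 1, 2/3, 5

Eighth layer of the toolkit for the one-step claim `LiYang2022_step` (Li–Yang, STOC 2022; full
version ECCC TR21-023, §3.3 "a circuit is called normalized if no normalization rule can apply
to it", Lemma 3.11, and §4.1 Case 0.1 "if the circuit is not normalized, we normalize it while
`Δμ ≥ 0`"). Everything is PROVED.

* `consistent_redirect_const_iff'`, `Fair.redirect_const'`, `ComputesRestr.redirect_const'` —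
  redirecting the wires of a gate to the constant forced by its own equation needs **no
  self-loop hypothesis** (the substituted and the self-read values agree); hence
  `rule_selfTwice`: a gate of the xor-part reading itself twice (`G = G ⊕ G ⊕ c = c`, the one
  corner of Rule 5 not covered by `rule5`) is eliminated with `Δμ ≥ 1 - α_φ`.
* `rule5_any` — Rule 5 for any gate with coinciding wires to a node other than itself, output
  or not, under the hypotheses of the one-step claim (`out_ne_of_coincide_triv`,
  `out_ne_of_coincide_var` exclude the impossible output cases; otherwise the output is moved,
  after flipping its live gate if needed).
* `PreNormalized` (no `0`-gate but the output, no constant wires, no coinciding wires; Rule 4 —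
  useless gates — is deliberately not part of it, and the printed *normalized* = all five rules
  is reserved for later) and **`exists_preNormalized`**: for
  `0 ≤ α_φ ≤ 1/2`, `0 ≤ α_I`, every fair semicircuit computing `f|_R` (an affine disperser for
  dimension `d`, `dim R ≥ 2d + 2`) with a packing normalizes without increasing the measure or
  the gate count — Case 0.1 of the proof of Thm. 4.1.

## References

* J. Li, T. Yang, *3.1n − o(n) circuit lower bounds for explicit functions*, STOC 2022
  [LiYang2022]; full version ECCC TR21-023, §3.3, Lemma 3.11, §4.1 (Case 0).
-/

namespace Literature.Computability.Complexity

open Finset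

namespace Semicircuit

variable {n : ℕ} (C : Semicircuit n) (k₀ : Fin C.m)

/-! ### Redirecting to a constant needs no self-loop hypothesis -/

/-- **Gate equations after redirecting to a constant** are equivalent to the old ones as soon
as the equation of `k₀` forces the constant — even if `k₀` reads itself (as a gate of the
xor-part reading itself twice does: `G = G ⊕ G ⊕ c = c`). [folklore] -/
theorem consistent_redirect_const_iff' (c : Bool)
    (hid : ∀ (x : Fin n → Bool) (w : Fin C.m → Bool),
      C.op k₀ (C.nodeVal x w (C.arg k₀ 0)) (C.nodeVal x w (C.arg k₀ 1)) = c)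
    (x : Fin n → Bool) (w : Fin C.m → Bool) :
    (C.redirect k₀ (.const c) false (C.redirectOK_const k₀ c)).Consistent x w ↔ C.Consistent x w := by
  have hv := C.redirectOK_const k₀ c
  -- input values agree once `w k₀ = c`
  have hin : ∀ (w : Fin C.m → Bool), w k₀ = c → ∀ (k : Fin C.m) (a : Fin 2),
      (C.nodeVal x w (if C.arg k a = .gate k₀ then .const c else C.arg k a) ^^
        (false && decide (C.arg k a = .gate k₀))) = C.nodeVal x w (C.arg k a) := by
    intro w hw k a
    rw [Bool.false_and, Bool.xor_false]
    split_ifs with h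
    · rw [h]; exact hw.symm
    · rfl
  unfold Consistent
  simp only [nodeVal_redirect_eq]
  constructor
  · intro h
    -- first `w k₀ = c`, comparing with the updated valuation
    have hw₀ : w k₀ = c := by
      have hk := h k₀
      set w'' := Function.update w k₀ c with hw''
      have key : ∀ a, C.nodeVal x w (if C.arg k₀ a = .gate k₀ then .const c else C.arg k₀ a) =
          C.nodeVal x w'' (C.arg k₀ a) := by
        intro a
        split_ifs with h'
        · rw [h']; show c = w'' k₀; rw [hw'']; simp
        · cases h'' : C.arg k₀ a with
          | const b => rfl
          | var i => rfl
          | gate k => show w k = w'' k; rw [hw'', Function.update_of_ne (fun hk => h' (by rw [h'', hk]))]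
      rw [Bool.false_and, Bool.false_and, Bool.xor_false, Bool.xor_false, key 0, key 1, hid] at hk
      exact hk
    intro k
    have := h k
    rwa [hin w hw₀ k 0, hin w hw₀ k 1] at this
  · intro h k
    have hw₀ : w k₀ = c := by rw [h k₀, hid]
    rw [hin w hw₀ k 0, hin w hw₀ k 1]
    exact h k

variable {C k₀} in
/-- Fairness is preserved (no self-loop hypothesis). [folklore] -/
theorem Fair.redirect_const' (hF : C.Fair) (c : Bool)
    (hid : ∀ (x : Fin n → Bool) (w : Fin C.m → Bool),
      C.op k₀ (C.nodeVal x w (C.arg k₀ 0)) (C.nodeVal x w (C.arg k₀ 1)) = c) :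
    (C.redirect k₀ (.const c) false (C.redirectOK_const k₀ c)).Fair := fun x => by
  obtain ⟨w, hw, huniq⟩ := hF x
  exact ⟨w, (C.consistent_redirect_const_iff' k₀ c hid x w).mpr hw,
    fun w' hw' => huniq w' ((C.consistent_redirect_const_iff' k₀ c hid x w').mp hw')⟩

variable {C k₀} in
/-- `f|_R` is still computed (no self-loop hypothesis). [folklore] -/
theorem ComputesRestr.redirect_const' {f : (Fin n → ZMod 2) → Bool} {R : RdqSource n}
    (hC : C.ComputesRestr f R) (c : Bool)
    (hid : ∀ (x : Fin n → Bool) (w : Fin C.m → Bool),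
      C.op k₀ (C.nodeVal x w (C.arg k₀ 0)) (C.nodeVal x w (C.arg k₀ 1)) = c) :
    (C.redirect k₀ (.const c) false (C.redirectOK_const k₀ c)).ComputesRestr f R := by
  refine ⟨fun i hi => ?_, fun u hu w hw => ?_⟩
  · rw [C.fanout_redirect_of_ne k₀ (.const c) false _ (by simp) (fun h => by cases h)]
    exact hC.1 i hi
  · rw [C.consistent_redirect_const_iff' k₀ c hid] at hw
    rw [redirect_out, nodeVal_redirect_eq]
    exact hC.2 u hu w hw

/-! ### A gate of the xor-part reading itself twice -/

variable {C k₀} in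
/-- **A gate whose two wires go to itself** (possible only in the xor-part; its equation is
`G = G ⊕ G ⊕ c = c`) can be eliminated with `Δμ ≥ 1 - α_φ`, if it is not the output: its readers
read the constant it computes, then the unread gate is deleted. [cite: LiYang2022, Lemma 3.11 (Rule 5)] -/
theorem rule_selfTwice {f : (Fin n → ZMod 2) → Bool} {R : RdqSource n} (hF : C.Fair)
    (hC : C.ComputesRestr f R) {P : Finset (Fin C.m × Fin C.m)} (hP : C.IsPacking P)
    (h0 : C.arg k₀ 0 = .gate k₀) (h1 : C.arg k₀ 1 = .gate k₀) (hout : C.out ≠ .gate k₀)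
    {αφ αI : ℝ} (hφ : 0 ≤ αφ) (hI : 0 ≤ αI) (αQ : ℝ) :
    ∃ (C' : Semicircuit n) (P' : Finset (Fin C'.m × Fin C'.m)), C'.Fair ∧ C'.ComputesRestr f R ∧
      C'.IsPacking P' ∧ C'.m + 1 = C.m ∧
      C'.measure αφ αI αQ P' R ≤ C.measure αφ αI αQ P R - (1 - αφ) := by
  have hK : k₀ ∈ C.xorPart := by
    by_contra hK
    exact C.arg_ne_self_of_not_mem hK 0 h0
  obtain ⟨c, hc⟩ := C.isXorOp_of_mem k₀ hK
  have hid : ∀ (x : Fin n → Bool) (w : Fin C.m → Bool),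
      C.op k₀ (C.nodeVal x w (C.arg k₀ 0)) (C.nodeVal x w (C.arg k₀ 1)) = c := by
    intro x w; rw [h0, h1, hc]; cases C.nodeVal x w (.gate k₀) <;> cases c <;> rfl
  have hk₀ : ¬ C.Troubled k₀ := not_troubled_of_coincide (h0.trans h1.symm)
  have hv := C.redirectOK_const k₀ c
  set C₁ := C.redirect k₀ (.const c) false hv with hC₁
  have hF₁ : C₁.Fair := hF.redirect_const' c hid
  have hC₁' : C₁.ComputesRestr f R := hC.redirect_const' c hid
  obtain ⟨hP₁, hμ₁⟩ := C.measure_redirect_const' k₀ hk₀ c false αφ αI αQ hP R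
  have h0₁ : C₁.fanout (.gate k₀) = 0 := C.fanout_redirect_self k₀ _ false hv (fun h => by cases h)
  have hco : C₁.arg k₀ 0 = C₁.arg k₀ 1 := by
    show (if C.arg k₀ 0 = .gate k₀ then Node.const c else C.arg k₀ 0) =
      (if C.arg k₀ 1 = .gate k₀ then Node.const c else C.arg k₀ 1)
    rw [if_pos h0, if_pos h1]
  obtain ⟨C', P', hF', hC', hP', hm, hμ⟩ := C₁.rule1_of_coincide k₀ hF₁ hC₁' hP₁ h0₁ hout hco hφ hI αQ
  exact ⟨C', P', hF', hC', hP', hm, by linarith⟩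


/-! ### Rule 5 at the output; Rule 5 for any gate -/

section Rule5Any

variable {C k₀}
variable {f : (Fin n → ZMod 2) → Bool} {R : RdqSource n} {d : ℕ}

/-- The value of a gate with coinciding wires is `ψ(u)` with `ψ t = op t t`. [folklore] -/
theorem op_eq_of_coincide (hco : C.arg k₀ 0 = C.arg k₀ 1) (x : Fin n → Bool) (w : Fin C.m → Bool) :
    C.op k₀ (C.nodeVal x w (C.arg k₀ 0)) (C.nodeVal x w (C.arg k₀ 1)) =
      (fun t => C.op k₀ t t) (C.nodeVal x w (C.arg k₀ 1)) := by
  rw [hco]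

/-- **A gate with coinciding wires and constant `ψ` is not the output** (the output would be
constant on `Sol R`). [cite: LiYang2022, proof of Thm. 4.1 (§4.1)] -/
theorem out_ne_of_coincide_triv (hf : IsAffineDisperser f d) (hd : 2 * d ≤ R.dim) (hF : C.Fair)
    (hC : C.ComputesRestr f R) (hco : C.arg k₀ 0 = C.arg k₀ 1)
    (htriv : C.op k₀ false false = C.op k₀ true true) : C.out ≠ .gate k₀ := by
  intro hout
  obtain ⟨u, hu, v, hv, huv⟩ := hf.exists_ne_of_sol R hd
  have key : ∀ u ∈ R.Sol, f u = C.op k₀ false false := by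
    intro u hu
    obtain ⟨w, hw, -⟩ := hF (boolOfZMod2.symm u)
    have h1 := hC.2 u hu w hw
    rw [hout] at h1
    rw [← h1]
    show w k₀ = _
    rw [hw k₀, hco]
    cases C.nodeVal (boolOfZMod2.symm u) w (C.arg k₀ 1)
    · rfl
    · exact htriv.symm
  exact huv ((key u hu).trans (key v hv).symm)

/-- **A gate with coinciding wires to a variable is not the output** on a source of dimension
`≥ 2d + 2` (the output would be a function of one coordinate). [cite: LiYang2022, proof of Thm. 4.1 (§4.1)] -/
theorem out_ne_of_coincide_var (hf : IsAffineDisperser f d) (hd : 2 * d + 2 ≤ R.dim) (hF : C.Fair)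
    (hC : C.ComputesRestr f R) (hco : C.arg k₀ 0 = C.arg k₀ 1) {i : Fin n} (h₁ : C.arg k₀ 1 = .var i) :
    C.out ≠ .gate k₀ := by
  intro hout
  obtain ⟨u, hu, v, hv, hij, huv⟩ := hf.exists_ne_of_sol_coord R hd i
  have key : ∀ u ∈ R.Sol, f u = C.op k₀ (boolOfZMod2.symm u i) (boolOfZMod2.symm u i) := by
    intro u hu
    obtain ⟨w, hw, -⟩ := hF (boolOfZMod2.symm u)
    have h1 := hC.2 u hu w hw
    rw [hout] at h1
    rw [← h1]
    show w k₀ = _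
    rw [hw k₀, hco, h₁]
    rfl
  have hi : boolOfZMod2.symm u i = boolOfZMod2.symm v i := by
    rw [Circuit.boolOfZMod2_symm_apply, Circuit.boolOfZMod2_symm_apply, hij]
  exact huv ((key u hu).trans (hi ▸ (key v hv).symm))

/-- **Rule 5 for any gate** whose two wires go to the same node `u ≠` itself (output or not),
under the hypotheses of the one-step claim: `Δμ ≥ 1 - α_φ`. [cite: LiYang2022, Lemma 3.11 (Rule 5)] -/
theorem rule5_any (hf : IsAffineDisperser f d) (hd : 2 * d + 2 ≤ R.dim) (hF : C.Fair)
    (hC : C.ComputesRestr f R) {P : Finset (Fin C.m × Fin C.m)} (hP : C.IsPacking P)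
    (hco : C.arg k₀ 0 = C.arg k₀ 1) (hu : C.arg k₀ 0 ≠ .gate k₀)
    {αφ αI : ℝ} (hφ : 0 ≤ αφ) (hI : 0 ≤ αI) (αQ : ℝ) :
    ∃ (C' : Semicircuit n) (P' : Finset (Fin C'.m × Fin C'.m)), C'.Fair ∧ C'.ComputesRestr f R ∧
      C'.IsPacking P' ∧ C'.m + 1 = C.m ∧
      C'.measure αφ αI αQ P' R ≤ C.measure αφ αI αQ P R - (1 - αφ) := by
  have hself : ∀ a, C.arg k₀ a ≠ .gate k₀ := by
    intro a
    obtain rfl | rfl : a = 0 ∨ a = 1 := by fin_cases a <;> simp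
    · exact hu
    · rw [← hco]; exact hu
  by_cases hout : C.out = .gate k₀
  · -- the output gate
    rcases bool_fn_const_or_xor (fun t => C.op k₀ t t) with htriv | hdeg
    · exact absurd hout (out_ne_of_coincide_triv hf (by omega) hF hC hco htriv)
    · cases h₁ : C.arg k₀ 1 with
      | const b => exact C.rule23 (a₀ := 1) hF hC hP h₁ hself (by
          -- impossible anyway, but `rule23` needs `out ≠ k₀`; use the const-const lemma
          exact out_ne_of_const_const (a₀ := 1) hf (by omega) hF hC h₁ (by
            rw [show (1 : Fin 2).rev = 0 from rfl, hco, h₁])) hφ hI αQ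
      | var i => exact absurd hout (out_ne_of_coincide_var hf hd hF hC hco h₁)
      | gate k₁ =>
        have hk : k₀ ≠ k₁ := fun h => hu (by rw [hco, h₁, h])
        have h₀ : C.arg k₀ 0 = .gate k₁ := hco.trans h₁
        cases hneg : C.op k₀ false false with
        | false =>
          -- `k₀ = k₁` as values: move the output to `k₁`
          have hval : ∀ (x : Fin n → Bool) (w : Fin C.m → Bool), C.Consistent x w →
              C.nodeVal x w (.gate k₁) = C.nodeVal x w C.out := by
            intro x w hw
            rw [hout]
            show w k₁ = w k₀
            rw [hw k₀, h₀, h₁, hdeg, hneg, Bool.xor_false]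
            rfl
          set C₂ := C.setOut (.gate k₁)
          obtain ⟨C', P', hF', hC', hP', hm, hμ⟩ := C₂.rule5 k₀ hF.setOut (hC.setOut hval)
            ((C.isPacking_setOut_iff _ P).mpr hP) hco hself (fun h => hk (Node.gate.inj h).symm) hφ hI αQ
          exact ⟨C', P', hF', hC', hP', hm, by rw [C.measure_setOut] at hμ; exact hμ⟩
        | true =>
          -- `k₀ = ¬ k₁`: flip `k₁`, then as above
          set C₂ := C.flipGate k₁ with hC₂
          have hF₂ : C₂.Fair := hF.flipGate
          have hC₂ : C₂.ComputesRestr f R := hC.flipGate (by rw [hout]; exact fun h => hk (Node.gate.inj h))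
          have hP₂ : C₂.IsPacking P := (C.isPacking_flipGate_iff k₁ P).mpr hP
          have hop₂ : ∀ t, C₂.op k₀ t t = t := by
            intro t
            show (if k₀ = k₁ then _ else C.op k₀ (t ^^ decide (C.arg k₀ 0 = .gate k₁))
              (t ^^ decide (C.arg k₀ 1 = .gate k₁))) = t
            rw [if_neg hk, h₀, h₁, decide_eq_true rfl, hdeg, hneg]
            cases t <;> rfl
          have hval : ∀ (x : Fin n → Bool) (w : Fin C.m → Bool), C₂.Consistent x w →
              C₂.nodeVal x w (.gate k₁) = C₂.nodeVal x w C₂.out := by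
            intro x w hw
            show w k₁ = C₂.nodeVal x w C.out
            rw [hout]
            show w k₁ = w k₀
            rw [hw k₀]
            show w k₁ = C₂.op k₀ (C₂.nodeVal x w (C.arg k₀ 0)) (C₂.nodeVal x w (C.arg k₀ 1))
            rw [h₀, h₁, hop₂]
            rfl
          set C₃ := C₂.setOut (.gate k₁)
          obtain ⟨C', P', hF', hC', hP', hm, hμ⟩ := C₃.rule5 k₀ hF₂.setOut (hC₂.setOut hval)
            ((C₂.isPacking_setOut_iff _ P).mpr hP₂) hco hself (fun h => hk (Node.gate.inj h).symm) hφ hI αQ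
          refine ⟨C', P', hF', hC', hP', hm, ?_⟩
          have : C₃.measure αφ αI αQ P R = C.measure αφ αI αQ P R :=
            (C₂.measure_setOut _ αφ αI αQ P R).trans (C.measure_flipGate k₁ αφ αI αQ P R)
          linarith
  · exact C.rule5 k₀ hF hC hP hco hself hout hφ hI αQ

end Rule5Any

/-! ### Pre-normalized circuits and the normalization lemma for Rules 1, 2/3, 5 -/

/-- A circuit is **pre-normalized**: normalized with respect to Rules 1, 2/3 and 5 only — its
only possible `0`-gate is the output, no gate reads a constant, no gate has coinciding wires.
Li–Yang's *normalized* (§3.3: "a circuit is called normalized if no normalization rule can apply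
to it") additionally excludes useless gates (Rule 4), not vendored yet; the name `Normalized` is
reserved for the five-rule notion. [cite: LiYang2022, §3.3] -/
structure PreNormalized (C : Semicircuit n) : Prop where
  /-- no `0`-gate but the output (Rule 1) -/
  out_of_fanout_eq_zero : ∀ k, C.fanout (.gate k) = 0 → C.out = .gate k
  /-- no gate fed by a constant (Rules 2, 3) -/
  arg_ne_const : ∀ k a b, C.arg k a ≠ .const b
  /-- no coinciding wires (Rule 5) -/
  arg_zero_ne_arg_one : ∀ k, C.arg k 0 ≠ C.arg k 1

variable {C} in
/-- A gate of the xor-part reading itself twice is not the output when an affine disperser is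
computed (its value is constant). [cite: LiYang2022, proof of Thm. 4.1 (§4.1)] -/
theorem out_ne_of_selfTwice {f : (Fin n → ZMod 2) → Bool} {R : RdqSource n} {d : ℕ}
    (hf : IsAffineDisperser f d) (hd : 2 * d ≤ R.dim) (hF : C.Fair) (hC : C.ComputesRestr f R)
    {k₀ : Fin C.m} (h0 : C.arg k₀ 0 = .gate k₀) (h1 : C.arg k₀ 1 = .gate k₀) : C.out ≠ .gate k₀ := by
  have hK : k₀ ∈ C.xorPart := by
    by_contra hK
    exact C.arg_ne_self_of_not_mem hK 0 h0
  obtain ⟨c, hc⟩ := C.isXorOp_of_mem k₀ hK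
  refine out_ne_of_coincide_triv hf hd hF hC (h0.trans h1.symm) ?_
  rw [hc, hc]; cases c <;> rfl

/-- **Normalization lemma for Rules 1, 2/3, 5** (Li–Yang Lemma 3.11 and Case 0.1: "since normalization will
decrease the complexity measure, it will not bother us to assume that the circuit is normalized
during gate elimination procedure"): under the hypotheses of the one-step claim and
`0 ≤ α_φ ≤ 1/2`, `0 ≤ α_I`, every fair semicircuit computing `f|_R` with a packing can be
pre-normalized (Rules 1, 2/3, 5) without increasing the measure or the number of gates, keeping
fairness, `f|_R` and a packing. [cite: LiYang2022, Lemma 3.11, §4.1 (Case 0.1)] -/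
theorem exists_preNormalized {f : (Fin n → ZMod 2) → Bool} {R : RdqSource n} {d : ℕ}
    (hf : IsAffineDisperser f d) (hd : 2 * d + 2 ≤ R.dim) {αφ αI : ℝ} (hφ : 0 ≤ αφ) (hφ' : αφ ≤ 1 / 2)
    (hI : 0 ≤ αI) (αQ : ℝ) :
    ∀ (m : ℕ) (D : Semicircuit n) (P : Finset (Fin D.m × Fin D.m)), D.m ≤ m → D.Fair → D.ComputesRestr f R →
      D.IsPacking P →
      ∃ (D' : Semicircuit n) (P' : Finset (Fin D'.m × Fin D'.m)), D'.PreNormalized ∧ D'.Fair ∧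
        D'.ComputesRestr f R ∧ D'.IsPacking P' ∧ D'.m ≤ D.m ∧
        D'.measure αφ αI αQ P' R ≤ D.measure αφ αI αQ P R := by
  intro m
  induction m with
  | zero =>
    intro D P hm hF hC hP
    refine ⟨D, P, ⟨fun k => ?_, fun k => ?_, fun k => ?_⟩, hF, hC, hP, le_rfl, le_rfl⟩
    all_goals exact absurd k.pos (by omega)
  | succ m ih =>
    intro D P hm hF hC hP
    -- one step of a rule, then the induction hypothesis
    have step : ∀ (D₁ : Semicircuit n) (P₁ : Finset (Fin D₁.m × Fin D₁.m)), D₁.Fair → D₁.ComputesRestr f R →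
        D₁.IsPacking P₁ → D₁.m + 1 = D.m → D₁.measure αφ αI αQ P₁ R ≤ D.measure αφ αI αQ P R →
        ∃ (D' : Semicircuit n) (P' : Finset (Fin D'.m × Fin D'.m)), D'.PreNormalized ∧ D'.Fair ∧
          D'.ComputesRestr f R ∧ D'.IsPacking P' ∧ D'.m ≤ D.m ∧
          D'.measure αφ αI αQ P' R ≤ D.measure αφ αI αQ P R := by
      intro D₁ P₁ hF₁ hC₁ hP₁ hm₁ hμ₁
      obtain ⟨D', P', hN, hF', hC', hP', hm', hμ'⟩ := ih D₁ P₁ (by omega) hF₁ hC₁ hP₁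
      exact ⟨D', P', hN, hF', hC', hP', by omega, hμ'.trans hμ₁⟩
    by_cases h1 : ∀ k, D.fanout (.gate k) = 0 → D.out = .gate k
    · by_cases h2 : ∀ k a b, D.arg k a ≠ .const b
      · by_cases h3 : ∀ k, D.arg k 0 ≠ D.arg k 1
        · exact ⟨D, P, ⟨h1, h2, h3⟩, hF, hC, hP, le_rfl, le_rfl⟩
        · push Not at h3
          obtain ⟨k₀, hco⟩ := h3
          by_cases hu : D.arg k₀ 0 = .gate k₀
          · have hout := out_ne_of_selfTwice hf (by omega) hF hC hu (hco ▸ hu)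
            obtain ⟨D₁, P₁, hF₁, hC₁, hP₁, hm₁, hμ₁⟩ := rule_selfTwice hF hC hP hu (hco ▸ hu) hout hφ hI αQ
            exact step D₁ P₁ hF₁ hC₁ hP₁ hm₁ (by linarith)
          · obtain ⟨D₁, P₁, hF₁, hC₁, hP₁, hm₁, hμ₁⟩ := rule5_any hf hd hF hC hP hco hu hφ hI αQ
            exact step D₁ P₁ hF₁ hC₁ hP₁ hm₁ (by linarith)
      · push Not at h2
        obtain ⟨k₀, a₀, b, h₀⟩ := h2
        obtain ⟨D₁, P₁, hF₁, hC₁, hP₁, hm₁, hμ₁⟩ :=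
          rule23_any hf hd hF hC hP h₀ (hF.not_reads_self_of_const h₀) hφ hI αQ
        exact step D₁ P₁ hF₁ hC₁ hP₁ hm₁ (by linarith)
    · push Not at h1
      obtain ⟨k₀, hk₀, hout⟩ := h1
      obtain ⟨D₁, P₁, hF₁, hC₁, hP₁, hm₁, hμ₁⟩ := rule1 hF hC hP hk₀ hout hφ hI αQ
      exact step D₁ P₁ hF₁ hC₁ hP₁ hm₁ (by linarith)
end Semicircuit

end Literature.Computability.Complexity
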